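import Summits.NavierStokesRegularity.NavierStokesRegularity.Theorems.StrainDoorsTypeITangentHessian
import Summits.NavierStokesRegularity.NavierStokesRegularity.Theorems.StrainDoorsPeakDoors
import HarnessLib

/-!
# StrainDoorsDirectionCoherence — PART M §M14: COHERENCE OF THE VORTICITY DIRECTION AT PARABOLIC SCALE

nsreg-p1 g36, ROUND-64 (helper lane of `stmt-NavierStokesRegularity-0056`, rung N0; 0 ledger writes by the
planner — text for the S-lane to land `--supports stmt-NavierStokesRegularity-0056 --as helper`; tree file 2 of 4
of ROUND-64; bodies farm-certified inside `r64/StrainDoorsR64All.lean`, rc 0 · 0 warn · 0 sorry, std axioms).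

The free (class-level) half of the direction-coherence door: for a classical Type-I ancient solution the
vorticity direction `ξ = ω/|ω|` is LIPSCHITZ AT PARABOLIC SCALE wherever the scale-invariant vorticity is not
small — with constants depending on `C₀` only:

* `norm_mul_norm_vorticityDirection_sub_le` — unit-vector algebra `|w(x)|·|ξ(y) − ξ(x)| ≤ 2|w(y) − w(x)|`;
* ★★ `typeI_vorticityDirection_coherence` — `(0 − t)|ω(t,x)|·|ξ(t,y) − ξ(t,x)| ≤ K·|y − x|/√(0 − t)` for ALL
  `x, y` (`ω(t,x) ≠ 0`), from the uniform gradient-Lipschitz bound of the class after rescaling;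
* ★★ `typeI_nearRecord_direction_coherence` — at a point with `(0 − t)|ω(t,x)| ≥ W − δ > 0`:
  `|ξ(t,y) − ξ(t,x)| ≤ K·ρ/(W − δ)`, `ρ = |y − x|/√(0 − t)`: the CONE CONDITION of the direction criteria
  (Constantin–Fefferman 1993; Giga–Miura 2011; arXiv:2501.08976 Thm 1.1) holds for free on the parabolic ball of
  radius `ρ√(0 − t)`, `ρ ≪ (W − δ)/K`, around every near-record.  What is NOT free (door K5 of the memo): coherence
  across the WHOLE high-vorticity region at a FIXED parabolic scale.  [new-as-typed]
-/

noncomputable section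

open MeasureTheory Set Function Filter Metric Real InnerProductSpace
open _root_.Topology
open scoped ENNReal NNReal RealInnerProductSpace ContDiff Laplacian
open Literature.Analysis Literature.Analysis.FluidPDE
open Literature.Analysis.FluidPDE.VorticityDirectionDynamics

set_option linter.dupNamespace false
set_option maxSynthPendingDepth 3

namespace Summit.NavierStokesRegularity.NavierStokesRegularity.Theorems.StrainDoors

open Summit.NavierStokesRegularity.NavierStokesRegularity.Theorems.ArgmaxDoors


/-! ## §M14 Direction coherence at parabolic scale (the free part of the double-cone door K5)

arXiv:2501.08976 (Thm 1.1): if the vorticity DIRECTIONS at high vorticity on a parabolic cylinder lie in a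
double cone, the solution is regular there.  In the Type-I class a weak, LOCAL version is automatic:
around any point the direction field is Lipschitz at the parabolic scale with constant `K/ρ̂`,
`ρ̂ = (0 − t)|ω(t,x)|` — so at a near-record (`ρ̂ ≈ W`) the directions on the parabolic ball of radius
`r√(0 − t)` lie in a cone of opening `≲ K r / W`.  The door K5 is the same conclusion on the whole
high-vorticity region of a cylinder of FIXED parabolic size. -/

/-- **Unit-vector comparison**: `|a|·‖b/|b| − a/|a|‖ ≤ 2‖b − a‖` for `a ≠ 0` (junk-free at `b = 0`, where
`b/|b| = 0`). [folklore] -/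
theorem norm_mul_norm_vorticityDirection_sub_le
    (w : (EuclideanSpace ℝ (Fin 3)) → (EuclideanSpace ℝ (Fin 3))) {x : EuclideanSpace ℝ (Fin 3)}
    (hx : w x ≠ 0) (y : EuclideanSpace ℝ (Fin 3)) :
    ‖w x‖ * ‖vorticityDirection w y - vorticityDirection w x‖ ≤ 2 * ‖w y - w x‖ := by
  have han : ‖w x‖ ≠ 0 := norm_ne_zero_iff.2 hx
  have ha0 : 0 < ‖w x‖ := norm_pos_iff.2 hx
  rw [vorticityDirection_apply, vorticityDirection_apply]
  by_cases hb : w y = 0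
  · rw [hb, norm_zero, inv_zero, zero_smul, zero_sub, norm_neg, norm_smul, norm_inv, norm_norm,
      inv_mul_cancel₀ han, mul_one, zero_sub, norm_neg]
    linarith [norm_nonneg (w x)]
  · have hbn : ‖w y‖ ≠ 0 := norm_ne_zero_iff.2 hb
    have hb0 : 0 < ‖w y‖ := norm_pos_iff.2 hb
    have e1 : ‖w x‖ * ‖‖w y‖⁻¹ • w y - ‖w x‖⁻¹ • w x‖ = ‖(‖w x‖ * ‖w y‖⁻¹) • w y - w x‖ := by
      rw [← Real.norm_of_nonneg (norm_nonneg (w x)), ← norm_smul, Real.norm_of_nonneg (norm_nonneg (w x)),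
        smul_sub, smul_smul, smul_smul, mul_inv_cancel₀ han, one_smul]
    have e2 : ‖(‖w x‖ * ‖w y‖⁻¹) • w y - w y‖ = |‖w x‖ - ‖w y‖| := by
      rw [show (‖w x‖ * ‖w y‖⁻¹) • w y - w y = (‖w x‖ * ‖w y‖⁻¹ - 1) • w y by rw [sub_smul, one_smul],
        norm_smul, Real.norm_eq_abs,
        show ‖w x‖ * ‖w y‖⁻¹ - 1 = (‖w x‖ - ‖w y‖) / ‖w y‖ by field_simp,
        abs_div, abs_of_pos hb0, div_mul_cancel₀ _ hbn]
    have h3 : |‖w x‖ - ‖w y‖| ≤ ‖w y - w x‖ := by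
      rw [abs_sub_comm]; exact abs_norm_sub_norm_le _ _
    calc ‖w x‖ * ‖‖w y‖⁻¹ • w y - ‖w x‖⁻¹ • w x‖ = ‖(‖w x‖ * ‖w y‖⁻¹) • w y - w x‖ := e1
      _ ≤ ‖(‖w x‖ * ‖w y‖⁻¹) • w y - w y‖ + ‖w y - w x‖ := norm_sub_le_norm_sub_add_norm_sub _ _ _
      _ = |‖w x‖ - ‖w y‖| + ‖w y - w x‖ := by rw [e2]
      _ ≤ ‖w y - w x‖ + ‖w y - w x‖ := by gcongr
      _ = 2 * ‖w y - w x‖ := by ring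

/-- ★★ **DIRECTION COHERENCE AT THE PARABOLIC SCALE (Type-I class).**  For every `C₀ ≥ 0` there is
`K = K(C₀) ≥ 0` (`K = 2‖curl‖K₂`, `K₂` the uniform Hessian bound of `exists_uniform_gradLipschitz`) such that for
every classical Type-I ancient solution, every `t < 0` and all `x, y` with `ω(t,x) ≠ 0`:
`(0 − t)|ω(t,x)| · ‖ξ(t,y) − ξ(t,x)‖ ≤ K·|y − x|/√(0 − t)`,
i.e. the direction field is `K/(ρ̂√(0 − t))`-Lipschitz around `x`, `ρ̂ = (0 − t)|ω(t,x)|`: on the parabolic ball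
`|y − x| ≤ r√(0 − t)` around a `δ`-near-record point (`ρ̂ ≥ W − δ`) all vorticity directions lie within
`K r/(W − δ)` of `ξ(t,x)` — a double cone of opening `O(r)`.  Rescale to time `−1`, Lipschitz bound of the
rescaled vorticity, unit-vector comparison. [new-as-typed; folklore mechanism] -/
theorem typeI_vorticityDirection_coherence {C₀ : ℝ} (hC₀ : 0 ≤ C₀) :
    ∃ K : ℝ, 0 ≤ K ∧ ∀ (u : ℝ → (EuclideanSpace ℝ (Fin 3)) → (EuclideanSpace ℝ (Fin 3)))
      (p : ℝ → (EuclideanSpace ℝ (Fin 3)) → ℝ) (t : ℝ) (x y : EuclideanSpace ℝ (Fin 3)),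
        IsClassicalNSSolutionOn (Iio 0) 1 0 u p → HasTypeIDecay C₀ u → t < 0 → curl (u t) x ≠ 0 →
        (0 - t) * ‖curl (u t) x‖ * ‖vorticityDirection (curl (u t)) y - vorticityDirection (curl (u t)) x‖ ≤
          K * (‖y - x‖ / √(0 - t)) := by
  obtain ⟨K₂, L₁, hK₂, hL₁, hG⟩ := exists_uniform_gradLipschitz hC₀
  obtain ⟨c, hc⟩ : ∃ c : ℝ, c = ‖(curlCLM : ((EuclideanSpace ℝ (Fin 3)) →L[ℝ] (EuclideanSpace ℝ (Fin 3))) →L[ℝ]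
      (EuclideanSpace ℝ (Fin 3)))‖ := ⟨_, rfl⟩
  have hc0 : 0 ≤ c := by rw [hc]; exact norm_nonneg _
  refine ⟨2 * (c * K₂), by positivity, fun u p t x y hsol hI ht hne => ?_⟩
  have ht0 : 0 < 0 - t := by linarith
  -- rescale to time `-1`
  obtain ⟨lam, hlam⟩ : ∃ lam : ℝ, lam = √(0 - t) := ⟨_, rfl⟩
  have hlam0 : 0 < lam := by rw [hlam]; exact Real.sqrt_pos.mpr (by linarith)
  have hlam2 : lam ^ 2 = 0 - t := by rw [hlam]; exact Real.sq_sqrt (by linarith)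
  have ht1 : lam ^ 2 * (-1) = t := by rw [hlam2]; ring
  obtain ⟨z, hz⟩ : ∃ z : EuclideanSpace ℝ (Fin 3), z = lam⁻¹ • x := ⟨_, rfl⟩
  have hxz : lam • z = x := by rw [hz]; exact smul_inv_smul₀ hlam0.ne' _
  obtain ⟨z', hz'⟩ : ∃ z' : EuclideanSpace ℝ (Fin 3), z' = lam⁻¹ • y := ⟨_, rfl⟩
  have hyz : lam • z' = y := by rw [hz']; exact smul_inv_smul₀ hlam0.ne' _
  have hcl := (typeI_class_nsRescale hlam0 hsol hI).1
  have hI' := (typeI_class_nsRescale hlam0 hsol hI).2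
  have hlip := curl_sub_le_of_fderiv_lipschitz ((hG hcl hI').1 (-1) (by norm_num)) z' z
  rw [← hc] at hlip
  have hzz : ‖z' - z‖ = ‖y - x‖ / √(0 - t) := by
    rw [← hlam, hz, hz', ← smul_sub, norm_smul, norm_inv, Real.norm_of_nonneg hlam0.le]
    field_simp
  have hcurl : ∀ y' : EuclideanSpace ℝ (Fin 3), curl (nsRescale lam u (-1)) y' = lam ^ 2 • curl (u t) (lam • y') :=
    fun y' => by rw [curl_eq_curlCLM, curl_eq_curlCLM, fderiv_nsRescale, map_smul, ht1]
  rw [hcurl, hcurl, hxz, hyz, ← smul_sub, norm_smul, Real.norm_of_nonneg (sq_nonneg lam), hlam2, hzz] at hlip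
  -- `hlip : (0 - t) * ‖ω(t,y) - ω(t,x)‖ ≤ c * K₂ * (‖y - x‖ / √(0 - t))`
  have hunit := norm_mul_norm_vorticityDirection_sub_le (curl (u t)) hne y
  calc (0 - t) * ‖curl (u t) x‖ * ‖vorticityDirection (curl (u t)) y - vorticityDirection (curl (u t)) x‖
      = (0 - t) * (‖curl (u t) x‖ * ‖vorticityDirection (curl (u t)) y - vorticityDirection (curl (u t)) x‖) := by
        ring
    _ ≤ (0 - t) * (2 * ‖curl (u t) y - curl (u t) x‖) := mul_le_mul_of_nonneg_left hunit ht0.le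
    _ = 2 * ((0 - t) * ‖curl (u t) y - curl (u t) x‖) := by ring
    _ ≤ 2 * (c * K₂ * (‖y - x‖ / √(0 - t))) := by gcongr
    _ = 2 * (c * K₂) * (‖y - x‖ / √(0 - t)) := by ring

/-- ★★ **DIRECTION COHERENCE AROUND A NEAR-RECORD (the local cone condition).**  With `K = K(C₀)` of
`typeI_vorticityDirection_coherence`: at a point `x` with `(0 − t)|ω(t,x)| ≥ W − δ > 0` (no domination
hypothesis is needed), for EVERY `y`,
`‖ξ(t,y) − ξ(t,x)‖ ≤ K·(|y − x|/√(0 − t))/(W − δ)`: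
the vorticity direction is `(Kρ/(W − δ))`-close to `ξ(t,x)` on the parabolic ball of radius `ρ√(0 − t)` — in
particular `|ξ(t,y) × ξ(t,x)| ≤ Kρ/(W − δ)` there: the cone condition of the direction-criteria
(Constantin–Fefferman; Giga–Miura; arXiv:2501.08976, Thm 1.1) holds FOR FREE at parabolic scale `ρ ≪ (W − δ)/K`
around every near-record.  [new-as-typed; corollary of §M14] -/
theorem typeI_nearRecord_direction_coherence {C₀ : ℝ} (hC₀ : 0 ≤ C₀) :
    ∃ K : ℝ, 0 ≤ K ∧
      ∀ (u : ℝ → (EuclideanSpace ℝ (Fin 3)) → (EuclideanSpace ℝ (Fin 3))) (p : ℝ → (EuclideanSpace ℝ (Fin 3)) → ℝ)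
        (W t δ : ℝ) (x y : EuclideanSpace ℝ (Fin 3)),
        IsClassicalNSSolutionOn (Iio 0) 1 0 u p → HasTypeIDecay C₀ u → t < 0 → δ < W →
        W - δ ≤ (0 - t) * ‖curl (u t) x‖ →
        ‖vorticityDirection (curl (u t)) y - vorticityDirection (curl (u t)) x‖ ≤
          K * (‖y - x‖ / √(0 - t)) / (W - δ) := by
  obtain ⟨K, hK, h⟩ := typeI_vorticityDirection_coherence hC₀
  refine ⟨K, hK, fun u p W t δ x y hsol hI ht hδW hnear => ?_⟩
  have hWδ : 0 < W - δ := by linarith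
  have hne : curl (u t) x ≠ 0 := by
    intro h0
    rw [h0, norm_zero, mul_zero] at hnear
    linarith
  have h1 := h u p t x y hsol hI ht hne
  rw [le_div_iff₀ hWδ]
  have hD : 0 ≤ ‖vorticityDirection (curl (u t)) y - vorticityDirection (curl (u t)) x‖ := norm_nonneg _
  nlinarith [mul_le_mul_of_nonneg_right hnear hD]

/-- ★ **THE TYPE-I BOUND ON THE BEIRÃO DA VEIGA–BERSELLI ½-HÖLDER INCOHERENCE.**  The regularity criterion of
Beirão da Veiga–Berselli (2002; Constantin–Fefferman 1993 with exponent `1`; Lemarié-Rieusset 2016, Thm 11.7)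
says a blow-up forces `sup_{|ω(x)|,|ω(y)| > R} |ξ(x) ∧ ξ(y)|/|x − y|^{1/2} → ∞`.  For a classical Type-I ancient
solution the ½-Hölder incoherence measured from a point of scale-invariant vorticity `(0 − t)|ω(t,x)| ≥ m > 0`
grows AT MOST like `(0 − t)^{−1/4}`: with `K = K(C₀)` of `typeI_vorticityDirection_coherence`, for every `y`,
`‖ξ(t,y) − ξ(t,x)‖²·√(0 − t) ≤ (6K/m)·|y − x|`
(interpolating the parabolic-scale Lipschitz bound with the trivial bound `‖ξ(y) − ξ(x)‖ ≤ 3`). [new-as-typed;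
dictionary to the fixed-scale direction criteria] -/
theorem typeI_direction_halfHolder_bound {C₀ : ℝ} (hC₀ : 0 ≤ C₀) :
    ∃ K : ℝ, 0 ≤ K ∧
      ∀ (u : ℝ → (EuclideanSpace ℝ (Fin 3)) → (EuclideanSpace ℝ (Fin 3))) (p : ℝ → (EuclideanSpace ℝ (Fin 3)) → ℝ)
        (m t : ℝ) (x y : EuclideanSpace ℝ (Fin 3)),
        IsClassicalNSSolutionOn (Iio 0) 1 0 u p → HasTypeIDecay C₀ u → t < 0 → 0 < m →
        m ≤ (0 - t) * ‖curl (u t) x‖ →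
        ‖vorticityDirection (curl (u t)) y - vorticityDirection (curl (u t)) x‖ ^ 2 * √(0 - t) ≤
          6 * K / m * ‖y - x‖ := by
  obtain ⟨K, hK, h⟩ := typeI_vorticityDirection_coherence hC₀
  refine ⟨K, hK, fun u p m t x y hsol hI ht hm hmx => ?_⟩
  have ht0 : 0 < 0 - t := by linarith
  have hs0 : 0 < √(0 - t) := Real.sqrt_pos.mpr ht0
  have hne : curl (u t) x ≠ 0 := by
    intro h0
    rw [h0, norm_zero, mul_zero] at hmx
    linarith
  have h1 := h u p t x y hsol hI ht hne
  -- `D ≤ 3`: `‖ξ(y)‖ ≤ 1`, `‖ξ(x)‖ ≤ 1` (crudely `≤ 3` to keep the arithmetic linear)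
  have hξle : ∀ z, ‖vorticityDirection (curl (u t)) z‖ ≤ 1 := fun z => by
    rw [vorticityDirection_apply, norm_smul, norm_inv, norm_norm]
    by_cases hz : ‖curl (u t) z‖ = 0
    · rw [hz, inv_zero, zero_mul]; exact zero_le_one
    · rw [inv_mul_cancel₀ hz]
  set D := ‖vorticityDirection (curl (u t)) y - vorticityDirection (curl (u t)) x‖ with hD
  have hD0 : 0 ≤ D := norm_nonneg _
  have hD3 : D ≤ 3 := by
    have := norm_sub_le (vorticityDirection (curl (u t)) y) (vorticityDirection (curl (u t)) x)
    linarith [hξle y, hξle x]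
  -- `m·√(0−t)·D ≤ (0−t)|ω(x)|·√(0−t)·D ≤ K|y − x|`
  have h2 : m * (√(0 - t) * D) ≤ K * ‖y - x‖ := by
    have h3 : (0 - t) * ‖curl (u t) x‖ * D ≤ K * (‖y - x‖ / √(0 - t)) := h1
    rw [← mul_div_assoc, le_div_iff₀ hs0] at h3
    have h4 : m * (√(0 - t) * D) ≤ (0 - t) * ‖curl (u t) x‖ * (√(0 - t) * D) :=
      mul_le_mul_of_nonneg_right hmx (by positivity)
    nlinarith
  rw [div_mul_eq_mul_div, le_div_iff₀ hm]
  have h5 : D ^ 2 * √(0 - t) * m ≤ 3 * (m * (√(0 - t) * D)) := by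
    have : D ^ 2 * √(0 - t) * m = D * (m * (√(0 - t) * D)) := by ring
    rw [this]
    exact mul_le_mul_of_nonneg_right hD3 (by positivity)
  nlinarith [h2, h5, norm_nonneg (y - x)]

end Summit.NavierStokesRegularity.NavierStokesRegularity.Theorems.StrainDoors
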